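import Summits.BirchSwinnertonDyer.BirchSwinnertonDyer.Theorems.TwoAdicConverseMultLambdaWallNonsplit
import Summits.BirchSwinnertonDyer.Rank1Residual.X2.IsogenyLambdaInvariant
import Summits.BirchSwinnertonDyer.Rank1Residual.X1.LambdaSqueezeAlgebra
import HarnessLib

/-!
# Route `TwoAdicConverse` (rung S3), multiplicative branch, NON-SPLIT sign: LINE `cycint` v3 ⟹ v4 in the kernel —
# the isogeny-hedged INTEGRAL wall implies the `λ`-form wall, modulo PRINT-located inputs only (items 19219 / 19187; helper)

Cell `bsd-2adic` (run/shared/lean/pub/bsd-2adic/), seat `bsd-2adic-conv-2` (GEN 12). THEOREMS ONLY — nothing asserted, no definition,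
no named fact, nothing booked; BSD is not proved by any of this. PARTITION (D-0054): none — RANK axis (S3 mult, non-split sign).

WHAT THIS FILE SETTLES (T1 bookkeeping of the v4 reshape, `Theorems/TwoAdicConverseMultLambdaWallNonsplit.lean`, p491683). LINE `cycint` v3
asked, on the finite-`Sel` non-split locus, the INTEGRAL Eisenstein direction `X5.O1.MultEisensteinDivisibilityAtTwo W'` at SOME
`ℚ`-isogenous globally minimal `W'`; v4 asks the `λ`-part AT `W` (λ-WALL-ns). The card of v4 recorded «v3-ns ⟹ v4-ns modulo the
`⊗ℚ`-isogeny invariance of `char_Λ X` (not a tree theorem)». That invariance is NOT needed: Kato's `⊗ℚ` divisibility AT `W'` (the K11a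
kernel, PRINT-located inputs `hne`, `h12`, `hdesc`, `h15`) supplies a factorisation `ι(g'·a) = 2^{n'}·L` through a generator `g'` of
`char_Λ X(W')`, the member-wise transport of p491683 (`multLambdaPartNonsplit_of_multEisenstein`) gives `λ(g'·a) ≤ λ(g')`, the two
factorisations of the SAME `L` give `λ(g·h) = λ(g'·a)` (`2^{n'}·(g·h) = 2ⁿ·(g'·a)` in `Λ`), and `λ(g) = λ(X(W)) = λ(X(W')) = λ(g')` is
Greenberg–Vatsal's isogeny invariance of `λ` (tree theorem `X2.IsogenyLambdaInvariant.lambda_eq_of_isogeny`, with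
`X1.ParitySqueeze.lam_generator_eq_lambdaInvariant`). Hence:

* `multLambdaPartNonsplit_of_isIsogenous_of_multEisenstein_of_descent` — for `W ∼ W'` globally minimal, `W` non-split multiplicative at
  `2`, `Mult W' 2` and `MultEisensteinDivisibilityAtTwo W'`: the `λ`-part at `W`, modulo PRINT {`hmod`, `hne`, `h12`, `hdesc`, `h15`};
* `lamWallNonsplit_of_wallS3Nonsplit_of_descent` — **v3's non-split stub ⟹ v4's non-split stub** (∀-closed, same PRINT-located inputs), so
  the reshape is a WEAKENING of the registered research object in the kernel, not only on paper;
* `nonsplitMultRankZeroTwoConverse_of_wallS3_of_descent'` — v3's non-split road recovered THROUGH v4 (consistency check: same conclusion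
  as `MultWalls.nonsplitMultRankZeroTwoConverse_of_wallS3`, now via the `λ`-road).

References: Greenberg–Vatsal, Invent. Math. 142 (2000) §2 p. 28 and p. 4 [GreenbergVatsal2000]; Kato, Astérisque 295 (2004) Thm. 17.4, §17.13
[Kato2004Asterisque]; Greenberg, LNM 1716 (1999) Thm. 1.5, §4 pp. 112–113 [GreenbergLNM1716]; Washington, GTM 83, §7.1, §13.2 [Washington1997].
-/

set_option linter.dupNamespace false
set_option autoImplicit false

noncomputable section

open scoped Classical MatrixGroups ModularForm

open CongruenceSubgroup WeierstrassCurve Literature.NumberTheory.EllipticCurves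
  Literature.NumberTheory.EllipticCurves.ModularForms
  Literature.NumberTheory.EllipticCurves.Greenberg1999
  Literature.NumberTheory.EllipticCurves.Rank1Residual
  Literature.NumberTheory.EllipticCurves.Rank1Residual.Typed
  Summit.BirchSwinnertonDyer.Rank1Residual.X1.MuLambda
  Summit.BirchSwinnertonDyer.Rank1Residual.X1.ParitySqueeze
  Summit.BirchSwinnertonDyer.Rank1Residual.X2.IsogenyLambdaInvariant
  Summit.BirchSwinnertonDyer.Rank1Residual.X5
  Summit.BirchSwinnertonDyer.Rank1Residual.X5.O1
  Summit.BirchSwinnertonDyer.BirchSwinnertonDyer.Theses.TwoAdicConverse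

namespace Summit.BirchSwinnertonDyer.BirchSwinnertonDyer.Theorems

namespace MultLambdaWall

/-! ## §1 Two factorisations of the same `L` have the same `λ` -/

section Algebra

variable {p : ℕ} [Fact p.Prime]

/-- If `ι x = pⁿ·L` and `ι y = p^{m}·L` with `y ≠ 0`, then `x ≠ 0` and `λ(x) = λ(y)`: `p^{m}·x = pⁿ·y` in `Λ` (injectivity of `ι`), and
constants have `λ = 0`. [cite: Washington1997, §7.1] -/
theorem lam_eq_of_iota_eq_of_iota_eq {x y : IwasawaAlgebra p} {n m : ℕ} {L : PowerSeries ℚ_[p]}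
    (hx : iwasawaToPowerSeries p x = PowerSeries.C ((p : ℚ_[p]) ^ n) * L)
    (hy : iwasawaToPowerSeries p y = PowerSeries.C ((p : ℚ_[p]) ^ m) * L) (hy0 : y ≠ 0) :
    x ≠ 0 ∧ lam x = lam y := by
  have heq : PowerSeries.C ((p : ℤ_[p]) ^ m) * x = PowerSeries.C ((p : ℤ_[p]) ^ n) * y := by
    apply iwasawaToPowerSeries_injective p
    rw [map_mul, map_mul, iwasawaToPowerSeries_C_natCast_pow, iwasawaToPowerSeries_C_natCast_pow, hx, hy]
    ring
  have hCm : (PowerSeries.C ((p : ℤ_[p]) ^ m) : IwasawaAlgebra p) ≠ 0 := C_pow_ne_zero m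
  have hCn : (PowerSeries.C ((p : ℤ_[p]) ^ n) : IwasawaAlgebra p) ≠ 0 := C_pow_ne_zero n
  have hx0 : x ≠ 0 := by
    intro h0
    rw [h0, mul_zero] at heq
    exact (mul_ne_zero hCn hy0) heq.symm
  refine ⟨hx0, ?_⟩
  have hl := congrArg lam heq
  rw [lam_mul hCm hx0, lam_mul hCn hy0, (mu_C_pow_and_lam_C_pow m).2, (mu_C_pow_and_lam_C_pow n).2] at hl
  omega

end Algebra

/-! ## §2 The `λ`-part at `W` from the integral wall at an isogenous `W'` -/

section Transport

variable {W W' : WeierstrassCurve ℚ} [W.IsElliptic] [W'.IsElliptic] [W.IsGloballyMinimal] [W'.IsGloballyMinimal]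

/-- **v3 ⟹ v4 per curve.** `W ∼ W'` `ℚ`-isogenous globally minimal elliptic curves, `W` NON-SPLIT multiplicative at `2`, `W'` multiplicative
at `2` with the integral Eisenstein direction `MultEisensteinDivisibilityAtTwo W'`; PRINT {modularity `hmod`, Kato `hne`/`h12`, the descended
package `hdesc`, Greenberg Thm. 1.5 `h15`}. Then the `λ`-part holds AT `W`: for `W`'s data `(κ, γ, f, D, g, h, n, L)` with `char X(W) = (g)`
and `ι(g·h) = 2ⁿ·L₂(f,−1)`, `g·h ≠ 0 ∧ λ(g·h) ≤ λ(g)`. Proof: `f` is a newform of `W'` (Faltings, `IsNewformOf.of_isIsogenous`); K11a at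
`W'` (`MultKatoRat.katoMultiplicativeDivisibilityRat_two_of_descent_nonsplit`) gives `g'' ∈ char X(W') = (g')` with `ι g'' = 2^{n'}·L`,
`g'' = a·g'`; the member-wise transport at `W'` (`multLambdaPartNonsplit_of_multEisenstein`, p491683) gives `λ(g'·a) ≤ λ(g')`; §1 gives
`λ(g·h) = λ(g'·a)`; and `λ(g) = λ(X(W)) = λ(X(W')) = λ(g')` (`lam_generator_eq_lambdaInvariant`, torsion by Thm. 1.5;
`lambda_eq_of_isogeny`). [cite: GreenbergVatsal2000, §2 p. 28 and p. 4] [cite: Kato2004Asterisque, Thm. 17.4 (1)(2) (p. 273; shape) and §17.13]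
[cite: GreenbergLNM1716, Thm. 1.5 (p. 61)] -/
theorem multLambdaPartNonsplit_of_isIsogenous_of_multEisenstein_of_descent
    (hmod : nonempty_modularParametrizationData) (hne : Kato2004.nonempty_iwasawaH1Data) (h12 : Kato2004.thm12_4)
    (hdesc : Kato2004.exists_multDivisibilityInputsDescent_nonsplit) (h15 : thm15_isTorsion_multiplicative_rat)
    (hiso : IsIsogenous W W') (hmult : Mult W 2) (hns : ¬ W.HasSplitMultiplicativeReductionAtPrime 2)
    (hmult' : Mult W' 2) (hE' : MultEisensteinDivisibilityAtTwo W') :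
    ∀ (κ : ZpExtension ℚ 2) (γ : Field.absoluteGaloisGroup ℚ), κ.IsCyclotomic →
      κ.IsTopGenerator γ → IsCyclotomicVariable 2 γ →
      ∀ ⦃N : ℕ⦄ [NeZero N] (f : CuspForm (Gamma0 N) 2), IsNewformOf W f →
      ∀ (D : W.SelmerDualData κ γ) (g h : IwasawaAlgebra 2) (n : ℕ), D.charIdeal = Ideal.span {g} →
      ∀ L : PowerSeries ℚ_[2], IsMultPAdicLFunctionOf f 2 (-1) L →
        iwasawaToPowerSeries 2 (g * h) = PowerSeries.C ((2 : ℚ_[2]) ^ n) * L →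
        g * h ≠ 0 ∧ lam (g * h) ≤ lam g := by
  intro κ γ hκ hγ hγ' N _ f hf D g h n hchar L hL hι
  haveI : Fact (Nat.Prime 2) := ⟨Nat.prime_two⟩
  have hiso' : IsIsogenous W' W := hiso.symm_of_charZero
  have hns' : ¬ W'.HasSplitMultiplicativeReductionAtPrime 2 :=
    fun h' => hns ((hasSplitMultiplicativeReductionAtPrime_two_iff_of_isIsogenous hiso).mpr h')
  have hf' : IsNewformOf W' f := hf.of_isIsogenous hiso'
  -- the `λ`-part at `W'` (member-wise transport of the integral wall)
  have hlam' := multLambdaPartNonsplit_of_multEisenstein W' hmod hmult' hns' hE'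
  -- a dual datum and a generator at `W'`
  obtain ⟨D'⟩ := W'.nonempty_selmerDualData_holds κ γ hγ
  haveI : Module.Finite (IwasawaAlgebra 2) D'.X := D'.module_finite_holds hγ
  haveI : Module.Finite (IwasawaAlgebra 2) D.X := D.module_finite_holds hγ
  haveI : (Module.charIdeal (IwasawaAlgebra 2) D'.X).IsPrincipal := charIdeal_isPrincipal_holds 2 D'.X
  obtain ⟨g', hg'⟩ := Submodule.IsPrincipal.principal (Module.charIdeal (IwasawaAlgebra 2) D'.X)
  have hchar' : D'.charIdeal = Ideal.span {g'} := hg'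
  have hg0 : g ≠ 0 := generator_ne_zero_of_charIdeal_eq W D hchar
  have hg'0 : g' ≠ 0 := generator_ne_zero_of_charIdeal_eq W' D' hchar'
  -- Kato `⊗ℚ` at `W'` (K11a kernel, PRINT-located inputs): `ι g'' = 2^{n'}·L`, `g'' ∈ (g')`
  have hK' : KatoMultiplicativeDivisibilityRat W' 2 :=
    MultKatoRat.katoMultiplicativeDivisibilityRat_two_of_descent_nonsplit W' hns' hne h12 hdesc h15
  obtain ⟨-, hnsK, -⟩ := hK' κ γ hκ hγ hγ' hmult' f hf' D'
  obtain ⟨n', g'', hg''mem, hι'⟩ := hnsK hns' L hL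
  rw [hchar'] at hg''mem
  obtain ⟨a, ha⟩ := Ideal.mem_span_singleton'.mp hg''mem
  have h22 : ((2 : ℕ) : ℚ_[2]) = (2 : ℚ_[2]) := by norm_num
  have hι'' : iwasawaToPowerSeries 2 (g' * a) = PowerSeries.C ((2 : ℚ_[2]) ^ n') * L := by
    rw [mul_comm, ha, hι', h22]
  -- the `λ`-part at `W'` applied to `(f, D', g', a, n')`
  obtain ⟨hg'a0, hle'⟩ := hlam' κ γ hκ hγ hγ' f hf' D' g' a n' hchar' L hL hι''
  -- the two factorisations of `L` have the same `λ`
  have hιn : iwasawaToPowerSeries 2 (g * h) = PowerSeries.C (((2 : ℕ) : ℚ_[2]) ^ n) * L := by rw [h22]; exact hι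
  have hιn' : iwasawaToPowerSeries 2 (g' * a) = PowerSeries.C (((2 : ℕ) : ℚ_[2]) ^ n') * L := by rw [h22]; exact hι''
  obtain ⟨hgh0, hlameq⟩ := lam_eq_of_iota_eq_of_iota_eq hιn hιn' hg'a0
  -- `λ(g) = λ(X(W)) = λ(X(W')) = λ(g')`
  have hX : D.IsTorsion := h15 W 2 hmult f hf κ γ hκ hγ D
  have hX' : D'.IsTorsion := h15 W' 2 hmult' f hf' κ γ hκ hγ D'
  have hlamg : lam g = D.lambda := lam_generator_eq_lambdaInvariant D.X hX hg0 hchar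
  have hlamg' : lam g' = D'.lambda := lam_generator_eq_lambdaInvariant D'.X hX' hg'0 hchar'
  obtain ⟨φ⟩ := hiso
  have hDD' : D.lambda = D'.lambda := lambda_eq_of_isogeny φ D D'
  refine ⟨hgh0, ?_⟩
  rw [hlameq, hlamg, hDD', ← hlamg']
  exact hle'

end Transport

/-! ## §3 v3's registered non-split stub ⟹ v4's registered non-split stub -/

/-- **LINE `cycint`: v3 `stub_eisNonsplitFinSel` ⟹ v4 `stub_lamNonsplitFinSel`, modulo PRINT-located inputs only** {modularity, Kato
`hne`/`h12`, `hdesc`, Greenberg Thm. 1.5}. So the GEN 12 reshape of the non-split research wall is a WEAKENING in the kernel (the converse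
direction fails: λ-WALL-ns carries no `μ`, no period, no integral unit). [cite: GreenbergVatsal2000, §2 p. 28 and p. 4]
[cite: Kato2004Asterisque, Thm. 17.4 (1)(2) (p. 273; shape) and §17.13] [cite: GreenbergLNM1716, Thm. 1.5 (p. 61)] -/
theorem lamWallNonsplit_of_wallS3Nonsplit_of_descent
    (hmod : nonempty_modularParametrizationData) (hne : Kato2004.nonempty_iwasawaH1Data) (h12 : Kato2004.thm12_4)
    (hdesc : Kato2004.exists_multDivisibilityInputsDescent_nonsplit) (h15 : thm15_isTorsion_multiplicative_rat)
    (hWns : ∀ (W : WeierstrassCurve ℚ) [W.IsElliptic] [W.IsGloballyMinimal], ¬ W.HasCM → Mult W 2 →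
      ¬ W.HasSplitMultiplicativeReductionAtPrime 2 → W.selmerCorank 2 = 0 →
        ∃ (W' : WeierstrassCurve ℚ) (_ : W'.IsElliptic) (_ : W'.IsGloballyMinimal),
          IsIsogenous W W' ∧ Mult W' 2 ∧ MultEisensteinDivisibilityAtTwo W') :
    ∀ (W : WeierstrassCurve ℚ) [W.IsElliptic] [W.IsGloballyMinimal], ¬ W.HasCM → Mult W 2 →
      ¬ W.HasSplitMultiplicativeReductionAtPrime 2 → W.selmerCorank 2 = 0 →
      ∀ (κ : ZpExtension ℚ 2) (γ : Field.absoluteGaloisGroup ℚ), κ.IsCyclotomic →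
      κ.IsTopGenerator γ → IsCyclotomicVariable 2 γ →
      ∀ ⦃N : ℕ⦄ [NeZero N] (f : CuspForm (Gamma0 N) 2), IsNewformOf W f →
      ∀ (D : W.SelmerDualData κ γ) (g h : IwasawaAlgebra 2) (n : ℕ), D.charIdeal = Ideal.span {g} →
      ∀ L : PowerSeries ℚ_[2], IsMultPAdicLFunctionOf f 2 (-1) L →
        iwasawaToPowerSeries 2 (g * h) = PowerSeries.C ((2 : ℚ_[2]) ^ n) * L →
        g * h ≠ 0 ∧ lam (g * h) ≤ lam g := by
  intro W _ _ hcm hmult hns hsel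
  obtain ⟨W', _, _, hiso, hmult', hE'⟩ := hWns W hcm hmult hns hsel
  exact multLambdaPartNonsplit_of_isIsogenous_of_multEisenstein_of_descent hmod hne h12 hdesc h15 hiso hmult hns hmult' hE'

/-- **Consistency: v3's non-split road THROUGH v4.** PRINT {A235-twin, modularity, Thm. 1.5, Kato `hne`/`h12`, `hdesc`} + v3's
`stub_eisNonsplitFinSel` ⟹ the non-split half of 19219, via `lamWallNonsplit_of_wallS3Nonsplit_of_descent` and p491683's
`nonsplitMultRankZeroTwoConverse_of_lamWallNonsplit_of_descent` (same conclusion as `MultWalls.nonsplitMultRankZeroTwoConverse_of_wallS3`,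
p441692, which needs no Kato input — here Kato is the price of the `λ`-detour). [cite: GreenbergLNM1716, §4 pp. 112–113 and Thm. 1.5 (p. 61)]
[cite: Kato2004Asterisque, Thm. 17.4 (1)(2) (p. 273; shape) and §17.13] -/
theorem nonsplitMultRankZeroTwoConverse_of_wallS3_of_descent'
    (h41ns : thm41Analogue_charValue_rankZero_numberField_anyPrime_oddLocalDegree)
    (hmod : nonempty_modularParametrizationData) (h15 : thm15_isTorsion_multiplicative_rat)
    (hne : Kato2004.nonempty_iwasawaH1Data) (h12 : Kato2004.thm12_4)
    (hdesc : Kato2004.exists_multDivisibilityInputsDescent_nonsplit)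
    (hWns : ∀ (W : WeierstrassCurve ℚ) [W.IsElliptic] [W.IsGloballyMinimal], ¬ W.HasCM → Mult W 2 →
      ¬ W.HasSplitMultiplicativeReductionAtPrime 2 → W.selmerCorank 2 = 0 →
        ∃ (W' : WeierstrassCurve ℚ) (_ : W'.IsElliptic) (_ : W'.IsGloballyMinimal),
          IsIsogenous W W' ∧ Mult W' 2 ∧ MultEisensteinDivisibilityAtTwo W') :
    ∀ (W : WeierstrassCurve ℚ) [W.IsElliptic] [W.IsGloballyMinimal], ¬ W.HasCM → Mult W 2 →
      ¬ W.HasSplitMultiplicativeReductionAtPrime 2 → W.selmerCorank 2 = 0 → W.analyticRank = 0 :=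
  nonsplitMultRankZeroTwoConverse_of_lamWallNonsplit_of_descent h41ns hmod h15 hne h12 hdesc
    (lamWallNonsplit_of_wallS3Nonsplit_of_descent hmod hne h12 hdesc h15 hWns)

end MultLambdaWall

end Summit.BirchSwinnertonDyer.BirchSwinnertonDyer.Theorems

end
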